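import Summits.ValiantsHypothesis.ValiantsHypothesis.Theorems.GeneratorObstructionsPerGenDegreeSuperQPSingerDesigns

/-!
# Route GeneratorObstructions — K1 `PerGenDegreeSuperQP` (stmt-ValiantsHypothesis-11654),
# line `per-side-atoms`: DIFFERENCE-SET DESIGNS — a cyclic `(j, m, λ)` difference set hits the ray
# `j = m(m-1)/λ + 1` of `S(per_m)`; Paley / complement instances (rays 11, 15, 15, 19, 13 of
# `S(per_6), S(per_7), S(per_8), S(per_9), S(per_9)`)

Generalisation of `…SingerDesigns` (`λ = 1`). Let `a : [m] ↪ ℤ/j` be a cyclic `(j, m, λ)`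
DIFFERENCE SET: every nonzero residue is a difference `a(i') - a(i)` in exactly `λ ≥ 1` ways
(so `λ (j - 1) = m(m - 1)`). The additive labels `ℓ(i', i) = a(i') - a(i)` put label `0` on the
diagonal (`m` cells) and every nonzero label on exactly `λ` off-diagonal cells; the matrix
`M = (λ I + m (J - I)) / (λ + m(m-1))` is doubly stochastic, positive, with FLAT `ℓ`-profile
`λ m / (λ + m(m-1))`, so the design criterion (`per_ray_hit_of_additive_design`) gives

* `per_ray_hit_of_differenceSet` / `per_exists_ray_atom_of_differenceSet` — **a cyclic
  `(j, m, λ)` difference set (`λ ≥ 1`, `j ≤ m²`) makes the chamber ray `(1^j)^*` of `S(per_m)` hit,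
  with an atom at its first weight.**

Families in print (existence NOT formalised; instances by `decide` below): Singer `(q²+q+1, q+1, 1)`
(ray `m² - m + 1`, file `…SingerDesigns`); their complements `(q²+q+1, q², q²-q)` (ray
`m + √m + 1` for `m = q²`); PALEY quadratic residues `(p, (p-1)/2, (p-3)/4)`, `p ≡ 3 (mod 4)` prime
(ray `2m + 1` for `m = (p-1)/2`); twin-prime / `PG(3,2)` sets such as `(15, 7, 3)` and complements;
the trivial sets `(j, j-1, j-2)` recover the Fermat–Chow ray `m + 1`. Instances here:
`(11,6,3)` → ray 11 of `S(per_6)`; `(15,7,3)` → ray 15 of `S(per_7)`; `(15,8,4)` → ray 15 of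
`S(per_8)`; `(19,9,4)` (Paley) → ray 19 of `S(per_9)`; `(13,9,6)` → ray 13 of `S(per_9)`.
Honest framing: unconditional occupancy theorems; `stub_atomLate` (`c ≥ 2`), K1 and `GenFlipThesis`
remain OPEN; first-occurrence degrees untouched; nothing here bears on VP versus VNP.
References: R. E. A. C. Paley, J. Math. Phys. 12 (1933); J. Singer, Trans. AMS 43 (1938);
M. Hall, *Combinatorial Theory* (1986) Ch. 11; [BurgisserIkenmeyer2017] Prop. 2.8 (corrected), Def. 3.3.
-/

set_option linter.dupNamespace false

noncomputable section

namespace Summit.ValiantsHypothesis.ValiantsHypothesis.Theorems.GeneratorObstructions.PerGenDegreeSuperQP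

open MvPolynomial
open Literature.NumberTheory.DiophantineGeometry Literature.Computability.AlgebraicComplexity
  Literature.Computability.Complexity

section DifferenceSet

variable {m j : ℕ} [NeZero j]

/-- **Difference-set designs hit long rays.** Let `a : [m] → ℤ/j` be injective with every
nonzero residue a difference `a i' - a i` in exactly `λ ≥ 1` ways (a cyclic `(j, m, λ)` difference
set, stated decidably as `#{p : a p.1 - a p.2 = y} = λ`), and `j ≤ m²`. Then the chamber ray
`(1^j)^*` of `S(per_m)` is hit: the additive design `ℓ(i',i) = a i' - a i` with the flat positive
coupling `M = (λ I + m (J - I)) / (λ + m(m-1))`. [cite: BurgisserIkenmeyer2017, Prop. 2.8 and Def. 3.3] -/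
theorem per_ray_hit_of_differenceSet (hjm : j ≤ m * m) (a : Fin m → Fin j)
    (ha : Function.Injective a) (lam : ℕ) (hlam : 0 < lam)
    (hdiff : ∀ y : Fin j, y ≠ 0 →
      (Finset.univ.filter fun p : Fin m × Fin m => a p.1 - a p.2 = y).card = lam) :
    ∃ k : ℕ, 0 < k ∧
      highestWeightSpace (orbitCoordRep (MvPolynomial.rename toLex (perPoly (Fin m) ℂ)) m)
        (partitionWeightLex m (Nat.Partition.rectangle j k)) ≠ ⊥ := by
  classical
  have hm : 0 < m := by
    rcases Nat.eq_zero_or_pos m with h | h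
    · subst h
      exact absurd hjm (by have := NeZero.ne j; omega)
    · exact h
  set D : ℚ := (lam : ℚ) + ((m : ℚ) * m - m) with hD
  have hL : (0 : ℚ) < lam := by exact_mod_cast hlam
  have hmm : (0 : ℚ) ≤ (m : ℚ) * m - m := by
    have h1 : (1 : ℚ) ≤ m := by exact_mod_cast hm
    nlinarith
  have hDpos : 0 < D := by rw [hD]; linarith
  set M : Matrix (Fin m) (Fin m) ℚ := fun i i' => if i = i' then (lam : ℚ) / D else (m : ℚ) / D
    with hMdef
  have hMpos : ∀ i i', 0 < M i i' := by
    intro i i'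
    rw [hMdef]
    simp only
    split_ifs <;> positivity
  have hline : ∀ i, ∑ i', M i i' = 1 := by
    intro i
    rw [hMdef]
    simp only
    rw [Finset.sum_ite, Finset.sum_const, Finset.sum_const, Finset.filter_eq, if_pos (Finset.mem_univ _),
      Finset.card_singleton, Finset.filter_ne, Finset.card_erase_of_mem (Finset.mem_univ _),
      Finset.card_univ, Fintype.card_fin, nsmul_eq_mul, nsmul_eq_mul]
    have hm1 : ((m - 1 : ℕ) : ℚ) = (m : ℚ) - 1 := by
      rw [Nat.cast_sub (by omega), Nat.cast_one]
    have hgoal : (lam : ℚ) / D + ((m : ℚ) - 1) * ((m : ℚ) / D) = 1 := by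
      rw [mul_div_assoc', ← add_div, div_eq_one_iff_eq hDpos.ne', hD]
      ring
    rw [hm1]
    simpa [Nat.cast_one, one_mul] using hgoal
  have hcol : ∀ i', ∑ i, M i i' = 1 := by
    intro i'
    have hsymm : ∀ i, M i i' = M i' i := by
      intro i; rw [hMdef]; simp only [eq_comm]
    simp_rw [hsymm]
    exact hline i'
  refine per_ray_hit_of_additive_design hjm a (fun i => -a i) M hMpos hline hcol
    ((lam : ℚ) * m / D) (by positivity) fun y => ?_
  by_cases hy : y = 0
  · subst hy
    have hinner : ∀ i : Fin m, ∑ i' : Fin m, (if a i' + -a i = 0 then M i i' else 0) = (lam : ℚ) / D := by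
      intro i
      have hiff : ∀ i', (a i' + -a i = 0) ↔ (i' = i) := by
        intro i'
        rw [← sub_eq_add_neg, sub_eq_zero]
        exact ⟨fun h => ha h, fun h => by rw [h]⟩
      simp_rw [hiff]
      rw [Finset.sum_ite_eq' Finset.univ i, if_pos (Finset.mem_univ _), hMdef]
      exact if_pos rfl
    simp_rw [hinner]
    rw [Finset.sum_const, Finset.card_univ, Fintype.card_fin, nsmul_eq_mul]
    ring
  · -- the `λ` off-diagonal cells of label `y`
    have hoff : ∀ p ∈ Finset.univ.filter (fun p : Fin m × Fin m => a p.1 - a p.2 = y), M p.2 p.1 = (m : ℚ) / D := by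
      intro p hp
      have hp' : a p.1 - a p.2 = y := (Finset.mem_filter.mp hp).2
      have hne : p.2 ≠ p.1 := by
        intro h
        apply hy
        rw [← hp', h, sub_self]
      rw [hMdef]
      exact if_neg hne
    rw [← Finset.sum_product' Finset.univ Finset.univ (fun i i' => if a i' + -a i = y then M i i' else 0),
      Finset.univ_product_univ]
    rw [Fintype.sum_equiv (Equiv.prodComm (Fin m) (Fin m)) _
      (fun p : Fin m × Fin m => if a p.1 - a p.2 = y then M p.2 p.1 else 0)
      (fun q => by simp only [Equiv.prodComm_apply, Prod.fst_swap, Prod.snd_swap, sub_eq_add_neg])]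
    rw [← Finset.sum_filter, Finset.sum_congr rfl hoff, Finset.sum_const, hdiff y hy, nsmul_eq_mul]
    ring

/-- **Difference-set designs, atom form**: under the hypotheses of `per_ray_hit_of_differenceSet` the
ray `j` of `S(per_m)` starts with an ATOM `(k₀^j)^*`. [cite: BurgisserIkenmeyer2017, Prop. 2.8 and Def. 3.3] -/
theorem per_exists_ray_atom_of_differenceSet (hjm : j ≤ m * m) (a : Fin m → Fin j)
    (ha : Function.Injective a) (lam : ℕ) (hlam : 0 < lam)
    (hdiff : ∀ y : Fin j, y ≠ 0 →
      (Finset.univ.filter fun p : Fin m × Fin m => a p.1 - a p.2 = y).card = lam) :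
    ∃ k₀ : ℕ, 0 < k₀ ∧
      highestWeightSpace (orbitCoordRep (MvPolynomial.rename toLex (perPoly (Fin m) ℂ)) m)
        (partitionWeightLex m (Nat.Partition.rectangle j k₀)) ≠ ⊥ ∧
      (∀ k : ℕ, 0 < k → k < k₀ →
        highestWeightSpace (orbitCoordRep (MvPolynomial.rename toLex (perPoly (Fin m) ℂ)) m)
          (partitionWeightLex m (Nat.Partition.rectangle j k)) = ⊥) ∧
      (∀ χ₁ χ₂ : Weight (MatIdx m),
        χ₁ + χ₂ = partitionWeightLex m (Nat.Partition.rectangle j k₀) →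
        χ₁ ≠ 0 → χ₂ ≠ 0 →
        highestWeightSpace (orbitCoordRep (MvPolynomial.rename toLex (perPoly (Fin m) ℂ)) m) χ₁ = ⊥ ∨
          highestWeightSpace (orbitCoordRep (MvPolynomial.rename toLex (perPoly (Fin m) ℂ)) m) χ₂ = ⊥) :=
  exists_least_rectangle_atom _ _ (Nat.pos_of_ne_zero (NeZero.ne j)) hjm
    (per_ray_hit_of_differenceSet hjm a ha lam hlam hdiff)

end DifferenceSet

/-! ### Instances: Paley sets and complements -/

section Instances

/-- **Ray 11 of `S(per_6)` is hit** — the `(11, 6, 3)` set `{0,2,6,7,8,10}` (complement of the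
Paley quadratic residues mod 11). [folklore] -/
theorem per_six_ray_eleven_hit :
    ∃ k : ℕ, 0 < k ∧
      highestWeightSpace (orbitCoordRep (MvPolynomial.rename toLex (perPoly (Fin 6) ℂ)) 6)
        (partitionWeightLex 6 (Nat.Partition.rectangle 11 k)) ≠ ⊥ :=
  per_ray_hit_of_differenceSet (m := 6) (j := 11) (by norm_num) ![0, 2, 6, 7, 8, 10] (by decide) 3
    (by norm_num) (by decide)

/-- **Ray 15 of `S(per_7)` is hit** — the `(15, 7, 3)` set `{0,1,2,4,5,8,10}` (points of `PG(3,2)`).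
[folklore] -/
theorem per_seven_ray_fifteen_hit :
    ∃ k : ℕ, 0 < k ∧
      highestWeightSpace (orbitCoordRep (MvPolynomial.rename toLex (perPoly (Fin 7) ℂ)) 7)
        (partitionWeightLex 7 (Nat.Partition.rectangle 15 k)) ≠ ⊥ :=
  per_ray_hit_of_differenceSet (m := 7) (j := 15) (by norm_num) ![0, 1, 2, 4, 5, 8, 10] (by decide) 3
    (by norm_num) (by decide)

/-- **Ray 15 of `S(per_8)` is hit** — the `(15, 8, 4)` set `{3,6,7,9,11,12,13,14}` (complement of
the `(15,7,3)` set). [folklore] -/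
theorem per_eight_ray_fifteen_hit :
    ∃ k : ℕ, 0 < k ∧
      highestWeightSpace (orbitCoordRep (MvPolynomial.rename toLex (perPoly (Fin 8) ℂ)) 8)
        (partitionWeightLex 8 (Nat.Partition.rectangle 15 k)) ≠ ⊥ :=
  per_ray_hit_of_differenceSet (m := 8) (j := 15) (by norm_num) ![3, 6, 7, 9, 11, 12, 13, 14]
    (by decide) 4 (by norm_num) (by decide)

/-- **Ray 19 of `S(per_9)` is hit** — the PALEY `(19, 9, 4)` set of quadratic residues mod 19.
[folklore] -/
theorem per_nine_ray_nineteen_hit :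
    ∃ k : ℕ, 0 < k ∧
      highestWeightSpace (orbitCoordRep (MvPolynomial.rename toLex (perPoly (Fin 9) ℂ)) 9)
        (partitionWeightLex 9 (Nat.Partition.rectangle 19 k)) ≠ ⊥ :=
  per_ray_hit_of_differenceSet (m := 9) (j := 19) (by norm_num) ![1, 4, 5, 6, 7, 9, 11, 16, 17]
    (by decide) 4 (by norm_num) (by decide)

/-- **Ray 13 of `S(per_9)` is hit** — the `(13, 9, 6)` set, complement of the Singer set
`{0,1,3,9} ⊂ ℤ/13`. [folklore] -/
theorem per_nine_ray_thirteen_hit :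
    ∃ k : ℕ, 0 < k ∧
      highestWeightSpace (orbitCoordRep (MvPolynomial.rename toLex (perPoly (Fin 9) ℂ)) 9)
        (partitionWeightLex 9 (Nat.Partition.rectangle 13 k)) ≠ ⊥ :=
  per_ray_hit_of_differenceSet (m := 9) (j := 13) (by norm_num) ![2, 4, 5, 6, 7, 8, 10, 11, 12]
    (by decide) 6 (by norm_num) (by decide)

end Instances

end Summit.ValiantsHypothesis.ValiantsHypothesis.Theorems.GeneratorObstructions.PerGenDegreeSuperQP

end
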